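import Mathlib
import Summits.NavierStokesRegularity.NavierStokesRegularity.Theorems.OrthantWakeDyadicBreakBelowOneSocket
import Summits.NavierStokesRegularity.NavierStokesRegularity.Theorems.SubOnsagerCeilingDefs
import HarnessLib

/-!
# `OrthantWake.DyadicBreakBelowOne` — the adapter from a SHELL BARRIER / TAIL CEILING to the socket
(helper file for item stmt-NavierStokesRegularity-24644 `OrthantWake.DyadicBreakBelowOne`, `--supports`;
LEAD-OW «adapter» of KEY-NS #140 (2)(iii) / #142 (3), made INTERVAL-FREE)

The socket `not_noGlobalCascade_dyadicTable_of_weightBound` (sibling file `…Socket.lean`) turns,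
at EVERY scale ratio `1+ε₀ > 1`, a `ν`-uniform weighted a-priori bound `(1+ε₀)^{wn}|X_{0,n}(t)| ≤ C`
with ANY exponent `w > 1/2` along the regular viscous solutions of the Katz–Pavlović chain into
`¬ NoGlobalCascade ε₀ dyadicTable X₀`.  The route SubOnsagerCeiling states its certified regions
in two shapes (file `SubOnsagerCeilingDefs.lean`): the SHELL BARRIER
`ShellBarrierAt R ε₀ α` (`(1+ε₀)^{2θk}·½X_{i,k}(t)² ≤ D·E₀`, `θ > 1/2`, uniformly in `ν`) and the
TAIL CEILING `CeilingAt R ε₀ α` (`Σ_{k=n..N} Σ_i ½X_{i,k}(t)² ≤ C·E₀·(1+ε₀)^{-2θn}`, `θ > 1/2`),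
typically as `∀ R, ∀ ε₀ ∈ I, ∀ α, IsScaledDyadic α → ShellBarrierAt R ε₀ α` on an `ε₀`-interval `I`
(landed instance: `dyadicRange_shellBarrierAt`, `I = [7/10, 1]`; in progress: the three-window
mid-range region `SubOnsagerCeilingDyadicMidRange*`).  This file is the one-line bridge between
the two, so that ANY such region closes item 24644 on its interval by name, with no further work:

* `weightBound_of_shellBound` — the arithmetic: `(1+ε₀)^{2θk}·½x² ≤ D·E₀ ⇒ (1+ε₀)^{θk}|x| ≤ √(2·D·E₀)`;
* `not_noGlobalCascade_dyadicTable_of_shellBarrierAt` — `ShellBarrierAt R ε₀ dyadicTable`, `R ≥ 2`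
  ⇒ `¬ NoGlobalCascade ε₀ dyadicTable X₀` for every datum (`w := θ`, `C := √(2·D·E₀)`);
* `not_noGlobalCascade_dyadicTable_of_ceilingAt` — the same from `CeilingAt R ε₀ dyadicTable`
  (one-term tail `N = n`, component `0`);
* `not_noGlobalCascade_dyadicTable_of_isScaledDyadic_shellBarrierAt` /
  `dyadicBreakBelowOne_on_of_shellBarrierAt` / `dyadicBreakBelowOne_on_of_ceilingAt` — the shapes
  the SubOnsagerCeiling files actually land (`∀ α, IsScaledDyadic α → …`, on an `ε₀`-interval
  `[a, b]` with `a > 0`), using `isScaledDyadic_dyadicTable` (`c = 1`).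

The table-class input of `ShellBarrierAt`/`CeilingAt` is `inTableClass_dyadicTable` (`R ≥ 2`), the
Kamke input is the socket's `dyadicSocket_kamke`.

HONEST FRAMING: statements about a MODEL lattice ODE (route OrthantWake, rung TL-M2Break); this
file proves no barrier and no ceiling — it only wires the two route vocabularies together; item
24644 stays open below the certified ranges; nothing here is a statement about the Navier–Stokes
equations, and no crux, rung target or summit is proved.
-/

noncomputable section

set_option linter.dupNamespace false

namespace Summit.NavierStokesRegularity.NavierStokesRegularity.Theorems

open Set
open Literature.Analysis.FluidPDE.TaoCascade
open Summit.NavierStokesRegularity.NavierStokesRegularity.Theorems.SubOnsagerCeiling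

/-- The dyadic member is a scaled dyadic table (`c = 1`). MODEL lattice statement. [this file] -/
theorem isScaledDyadic_dyadicTable : IsScaledDyadic dyadicTable :=
  ⟨1, one_pos, fun _ _ _ _ => (one_mul _).symm⟩

/-- The arithmetic of the adapter: a weighted ENERGY bound `b^{2θk}·½x² ≤ D·E₀` (`b > 0`) is the
weighted AMPLITUDE bound `b^{θk}|x| ≤ √(2·D·E₀)`. [folklore] -/
theorem weightBound_of_shellBound {b θ x D E₀ : ℝ} {k : ℕ} (hb : 0 < b)
    (h : b ^ (2 * θ * (k : ℝ)) * ((1 / 2 : ℝ) * x ^ 2) ≤ D * E₀) :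
    b ^ (θ * (k : ℝ)) * |x| ≤ Real.sqrt (2 * D * E₀) := by
  have hP : 0 < b ^ (θ * (k : ℝ)) := Real.rpow_pos_of_pos hb _
  have hP2 : (b ^ (θ * (k : ℝ))) ^ 2 = b ^ (2 * θ * (k : ℝ)) := by
    rw [← Real.rpow_natCast, ← Real.rpow_mul hb.le]
    congr 1
    push_cast
    ring
  have hsq : (b ^ (θ * (k : ℝ)) * |x|) ^ 2 ≤ 2 * D * E₀ := by
    rw [mul_pow, sq_abs, hP2]
    linarith
  have h0 : 0 ≤ b ^ (θ * (k : ℝ)) * |x| := mul_nonneg hP.le (abs_nonneg _)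
  calc b ^ (θ * (k : ℝ)) * |x| = Real.sqrt ((b ^ (θ * (k : ℝ)) * |x|) ^ 2) := (Real.sqrt_sq h0).symm
    _ ≤ Real.sqrt (2 * D * E₀) := Real.sqrt_le_sqrt hsq

/-- **Shell barrier ⇒ no Theorem-4.2 blow-up for the dyadic member.** If `ShellBarrierAt R ε₀ dyadicTable`
holds for some spread `R ≥ 2` (so that `dyadicTable ∈ E₂(R)` discharges its table-class premise and
`dyadicSocket_kamke` its Kamke premise), then for every one-shell datum `X₀`,
`¬ NoGlobalCascade ε₀ dyadicTable X₀`: the barrier's `ν`-uniform bound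
`(1+ε₀)^{2θk}·½X_{0,k}(t)² ≤ D·E₀`, `θ > 1/2`, is the socket's weighted bound with `w = θ`,
`C = √(2·D·E₀)` (`weightBound_of_shellBound`), and `not_noGlobalCascade_dyadicTable_of_weightBound`
concludes. MODEL lattice statement. [this file] -/
theorem not_noGlobalCascade_dyadicTable_of_shellBarrierAt {R ε₀ : ℝ} (hR : 2 ≤ R) (hε₀ : 0 < ε₀)
    (h : ShellBarrierAt R ε₀ dyadicTable) (X₀ : Fin 4 → ℝ) :
    ¬ NoGlobalCascade ε₀ dyadicTable X₀ := by
  apply not_noGlobalCascade_dyadicTable_of_weightBound hε₀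
  intro ν hν
  obtain ⟨θ, hθ, D, _hD, hbar⟩ := h (inTableClass_dyadicTable hR) dyadicSocket_kamke
  refine ⟨θ, Real.sqrt (2 * D * ∑ j : Fin 4, (1 / 2 : ℝ) * X₀ j ^ 2), hθ, ?_⟩
  intro s hs X hinit hlow hbd hcont hder hnonneg n t ht
  have hb0 : (0 : ℝ) < 1 + ε₀ := by linarith
  exact weightBound_of_shellBound hb0 (hbar ν hν X₀ s hs X hinit hlow hbd hcont hder hnonneg t ht 0 n)

/-- **Tail ceiling ⇒ no Theorem-4.2 blow-up for the dyadic member.** If `CeilingAt R ε₀ dyadicTable`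
holds for some `R ≥ 2`, then `¬ NoGlobalCascade ε₀ dyadicTable X₀` for every datum: the one-term
tail `N = n`, component `0`, of the ceiling `Σ_{k=n..N} Σ_i ½X² ≤ C·E₀·(1+ε₀)^{-2θn}` is the shell
bound `(1+ε₀)^{2θn}·½X_{0,n}² ≤ C·E₀`, and `not_noGlobalCascade_dyadicTable_of_weightBound`
concludes with `w = θ`. MODEL lattice statement. [this file] -/
theorem not_noGlobalCascade_dyadicTable_of_ceilingAt {R ε₀ : ℝ} (hR : 2 ≤ R) (hε₀ : 0 < ε₀)
    (h : CeilingAt R ε₀ dyadicTable) (X₀ : Fin 4 → ℝ) :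
    ¬ NoGlobalCascade ε₀ dyadicTable X₀ := by
  apply not_noGlobalCascade_dyadicTable_of_weightBound hε₀
  intro ν hν
  obtain ⟨θ, hθ, C, _hC, hceil⟩ := h (inTableClass_dyadicTable hR) dyadicSocket_kamke
  refine ⟨θ, Real.sqrt (2 * C * ∑ j : Fin 4, (1 / 2 : ℝ) * X₀ j ^ 2), hθ, ?_⟩
  intro s hs X hinit hlow hbd hcont hder hnonneg n t ht
  have hb0 : (0 : ℝ) < 1 + ε₀ := by linarith
  have hc := hceil ν hν X₀ s hs X hinit hlow hbd hcont hder hnonneg n n le_rfl t ht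
  rw [Finset.Icc_self, Finset.sum_singleton] at hc
  -- single out component `0` of the shell sum
  have h0 : (1 / 2 : ℝ) * X 0 (n : ℤ) t ^ 2 ≤ ∑ i : Fin 4, (1 / 2 : ℝ) * X i (n : ℤ) t ^ 2 :=
    Finset.single_le_sum (f := fun i => (1 / 2 : ℝ) * X i (n : ℤ) t ^ 2) (fun i _ => by positivity)
      (Finset.mem_univ 0)
  have hw : 0 < (1 + ε₀) ^ (2 * θ * (n : ℝ)) := Real.rpow_pos_of_pos hb0 _
  have hinv : (1 + ε₀) ^ (2 * θ * (n : ℝ)) * (1 + ε₀) ^ (-(2 * θ * (n : ℝ))) = 1 := by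
    rw [← Real.rpow_add hb0, add_neg_cancel, Real.rpow_zero]
  apply weightBound_of_shellBound hb0 (D := C)
  calc (1 + ε₀) ^ (2 * θ * (n : ℝ)) * ((1 / 2 : ℝ) * X 0 (n : ℤ) t ^ 2)
      ≤ (1 + ε₀) ^ (2 * θ * (n : ℝ)) *
          (C * (∑ i : Fin 4, (1 / 2 : ℝ) * X₀ i ^ 2) * (1 + ε₀) ^ (-(2 * θ * (n : ℝ)))) :=
        mul_le_mul_of_nonneg_left (h0.trans hc) hw.le
    _ = C * (∑ i : Fin 4, (1 / 2 : ℝ) * X₀ i ^ 2) *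
          ((1 + ε₀) ^ (2 * θ * (n : ℝ)) * (1 + ε₀) ^ (-(2 * θ * (n : ℝ)))) := by ring
    _ = C * ∑ j : Fin 4, (1 / 2 : ℝ) * X₀ j ^ 2 := by rw [hinv, mul_one]

/-- The shape the SubOnsagerCeiling files land: a shell barrier for EVERY scaled dyadic table at
one ratio gives `¬ NoGlobalCascade` for the dyadic member (`c = 1`, `isScaledDyadic_dyadicTable`).
MODEL lattice statement. [this file] -/
theorem not_noGlobalCascade_dyadicTable_of_isScaledDyadic_shellBarrierAt {R ε₀ : ℝ} (hR : 2 ≤ R)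
    (hε₀ : 0 < ε₀)
    (h : ∀ α : Fin 4 → Fin 4 → Fin 4 → ℤ × ℤ × ℤ → ℝ, IsScaledDyadic α → ShellBarrierAt R ε₀ α)
    (X₀ : Fin 4 → ℝ) : ¬ NoGlobalCascade ε₀ dyadicTable X₀ :=
  not_noGlobalCascade_dyadicTable_of_shellBarrierAt hR hε₀ (h dyadicTable isScaledDyadic_dyadicTable) X₀

/-- **Item 24644 on a certified interval, from a shell-barrier region.** If for every spread `R`
and every `ε₀ ∈ [a, b]` (`a > 0`) every scaled dyadic table obeys `ShellBarrierAt R ε₀ α` — the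
exact shape of `dyadicRange_shellBarrierAt` (`[a,b] = [7/10,1]`) and of its successors — then
`∀ ε₀ ∈ [a, b], ∀ X₀, ¬ NoGlobalCascade ε₀ dyadicTable X₀`. MODEL lattice statement. [this file] -/
theorem dyadicBreakBelowOne_on_of_shellBarrierAt {a b : ℝ} (ha : 0 < a)
    (h : ∀ R : ℝ, ∀ ε₀ : ℝ, a ≤ ε₀ → ε₀ ≤ b →
      ∀ α : Fin 4 → Fin 4 → Fin 4 → ℤ × ℤ × ℤ → ℝ, IsScaledDyadic α → ShellBarrierAt R ε₀ α) :
    ∀ ε₀ : ℝ, a ≤ ε₀ → ε₀ ≤ b → ∀ X₀ : Fin 4 → ℝ, ¬ NoGlobalCascade ε₀ dyadicTable X₀ :=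
  fun ε₀ h₁ h₂ X₀ =>
    not_noGlobalCascade_dyadicTable_of_isScaledDyadic_shellBarrierAt (le_refl (2 : ℝ))
      (lt_of_lt_of_le ha h₁) (h 2 ε₀ h₁ h₂) X₀

/-- **Item 24644 on a certified interval, from a tail-ceiling region** (shape of the crux
`ForwardTailCeilingKP` / `CeilingAt` restricted to scaled dyadic tables on `[a, b]`, `a > 0`).
MODEL lattice statement. [this file] -/
theorem dyadicBreakBelowOne_on_of_ceilingAt {a b : ℝ} (ha : 0 < a)
    (h : ∀ R : ℝ, ∀ ε₀ : ℝ, a ≤ ε₀ → ε₀ ≤ b →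
      ∀ α : Fin 4 → Fin 4 → Fin 4 → ℤ × ℤ × ℤ → ℝ, IsScaledDyadic α → CeilingAt R ε₀ α) :
    ∀ ε₀ : ℝ, a ≤ ε₀ → ε₀ ≤ b → ∀ X₀ : Fin 4 → ℝ, ¬ NoGlobalCascade ε₀ dyadicTable X₀ :=
  fun ε₀ h₁ h₂ X₀ =>
    not_noGlobalCascade_dyadicTable_of_ceilingAt (le_refl (2 : ℝ)) (lt_of_lt_of_le ha h₁)
      (h 2 ε₀ h₁ h₂ dyadicTable isScaledDyadic_dyadicTable) X₀

end Summit.NavierStokesRegularity.NavierStokesRegularity.Theorems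

end
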